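import Summits.NavierStokesRegularity.NavierStokesRegularity.Theses.LebesgueExponentPincer
import HarnessLib.Audit

/-!
# Birth skeleton (BC3) of the crux `LebesgueExponentPincer.SuperEnergyJaw` — line `birth` (q-energy)

Crux item `stmt-NavierStokesRegularity-19240` (decl
`Summit.NavierStokesRegularity.NavierStokesRegularity.Theses.LebesgueExponentPincer.SuperEnergyJaw`,
crux rank 2 = the attacked conjunct K1 of route `route-NavierStokesRegularity-LebesgueExponentPincer`,
route file rev 0, re-audit bin HONEST). Tree path `Cruxes/SuperEnergyJaw/Lines/birth.lean`; registrar
`planner-skel-stmt-NavierStokesRegularity-19240-0`, 2026-08-17 (skeleton-register one-shot).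

PROVENANCE. The opening planner (`planner-type-b6f4c85dbd-0`) registered a birth skeleton with the stub
NAMES `stub_qEnergyInequality : QEnergyInequality`, `stub_pressureWorkBound : PressureWorkBound` (local
`def`s of its own file; `ledger skeleton check` OK) but could not `crux write` it (not the naming seat), and
its file is not readable from registrar seats. This file RE-TYPES the same line — the route header's own
TWO-LAYER PLAN "SuperEnergyJaw ⇐ QEnergyInequality → PressureWorkBound → SuperEnergyJaw" — keeping the
two stub names and stating both stubs INLINE over existing declarations only (Mathlib `eLpNorm` /
`lintegral` / `fderiv`, Literature `IsClassicalNSSolutionOn` / `IsLerayHopfOn` / `HasRapidSpatialDecay`),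
so that the registered signatures are self-contained. Nothing here is new mathematics.

THE CRUX (K1, super-energy jaw). For every `q ∈ (2, 3)`, every `ν, T > 0` and every classical
Navier–Stokes solution `(u, p)` on `ℝ³ × [0, T)` (`f = 0`) that is Leray–Hopf on `[0, T)` from its
rapidly decaying datum `u 0`: `sup_{t ∈ [0,T)} ‖u(t)‖_{L^q} < ∞`, typed as
`(⨆ t ∈ Ico 0 T, eLpNorm (u t) (ENNReal.ofReal q) volume) < ⊤`.

THE LINE (L^q energy identity in a free pressure gauge). Test the momentum equation with
`|u|^{q-2} u` (`q > 2`): transport cancels exactly, `∫ (u·∇u)·|u|^{q-2}u = ∫ u·∇(|u|^q/q) = 0`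
(`div u = 0`); the viscous term gives the q-dissipation
`-ν∫ Δu·|u|^{q-2}u = ν∫ |u|^{q-2}|∇u|² + ν(q-2)∫ |u|^{q-2}|∇|u||² ≥ ν∫ |u|^{q-2}|∇u|²`;
and for ANY gauge constant `c = c(t)` the pressure term is
`-∫ ∇p·|u|^{q-2}u = ∫ (p-c) div(|u|^{q-2}u) = (q-2)∫ (p-c)|u|^{q-3} u·∇|u|`, of modulus
`≤ (q-2)∫ |p-c| |u|^{q-2} ‖∇u‖`. Integrating in time:
`∫|u(t)|^q + qν ∫₀ᵗ∫ |u|^{q-2}‖∇u‖² ≤ ∫|u₀|^q + q(q-2) Π_q(c; t)`,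
`Π_q(c; t) := ∫₀ᵗ∫ |p-c| |u|^{q-2} ‖∇u‖` (Barker arXiv:2111.14776, p. 4, the q-energy bound up to `T*`
under a weak-`L^{3/2}` pressure hypothesis; Leslie–Shvydkoy arXiv:1705.04420 for the energy-measure
language). So the crux reduces to the finiteness of ONE gauge-fixed pressure-work functional
`Π_q(c; T)` for `q < 3`, plus `u₀ ∈ L^q` (proved here from the rapid decay of the datum).

THE CUT (two named stubs, the route header's plan verbatim; one proved helper):

* `stub_qEnergyInequality` (M/L, PROVABLE NOW — the q-energy inequality, free gauge). For every `q > 2`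
  (no upper bound is needed for this step), every classical solution on `[0, T)` that is Leray–Hopf from a
  rapidly decaying datum, EVERY gauge `c : ℝ → ℝ` and every `t ∈ [0, T)`:
  `∫⁻|u t|ₑ^q + ofReal(qν)·∫⁻_{(0,t)}∫⁻ |u|ₑ^{q-2}‖∇u‖ₑ² ≤ ∫⁻|u 0|ₑ^q + ofReal(q(q-2))·∫⁻_{(0,t)}∫⁻ |p-c|ₑ|u|ₑ^{q-2}‖∇u‖ₑ`
  (all lower Lebesgue integrals in `ℝ≥0∞`: no Bochner junk; a bad gauge only enlarges the right side).
  What is genuinely to do: the a-priori spatial decay of `u(t)`, `∇u(t)`, `p(t) - c(t)` for `t < T` that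
  justifies the integrations by parts — the Leray–Hopf classical solution coincides with Kato's mild
  solution from `u 0` (weak–strong uniqueness, tree `weak_strong_uniqueness_holds`) whose maximal time is
  `≥ T` (far-field regularity: no blow-up at spatial infinity), and mild solutions from rapidly decaying
  data keep `|u(t,x)| ≲ (1+|x|)^{-4}`, `|∇u| ≲ (1+|x|)^{-4}`, `|p - p_∞(t)| ≲ (1+|x|)^{-3}` on compact
  sub-intervals (Brandolese / Kukavica–Torres weighted persistence); or a cut-off-and-limit proof. Why
  plausibly true: it is the classical `L^q` energy equality for smooth decaying solutions (Lemarié-Rieusset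
  2016, Ch. 7; RRS16 §6), weakened to an inequality.
* `stub_pressureWorkBound` (XL, OPEN — the whole open content of K1, honestly isolated). For every
  `q ∈ (2, 3)` and every classical solution on `[0, T)` that is Leray–Hopf from a rapidly decaying datum
  there is a gauge `c : ℝ → ℝ` with `Π_q(c; T) = ∫⁻_{(0,T)}∫⁻ |p-c|ₑ |u|ₑ^{q-2} ‖∇u‖ₑ < ⊤`. Why it might
  fail (filed on the item): a Type-II first singularity at `T` concentrating `O(1)` energy at scale
  `r(t) → 0` (energy atom; Tao's averaged cascade is the model inhabitant) makes `‖u(t)‖_q → ∞` for every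
  `q > 2`, hence `Π_q = ∞` by `stub_qEnergyInequality`; nothing proved excludes it for true NS. Nearest
  proved neighbour: Barker arXiv:2111.14776 Thm 1 (finite under `p ∈ L^∞_t L^{3/2,∞}_x`). It is NOT
  implied by the crux cheaply either (`sup_t ‖u‖_q < ∞` for all `q < 3` does not put
  `|p||u|^{q-2}‖∇u‖` in `L¹_{t,x}`: Hölder in `x` misses by `1/2`), so the cut is a genuine
  strengthening-by-mechanism, not a rewording.
* `lintegral_rpow_enorm_lt_top_of_hasRapidSpatialDecay` (PROVED here): a rapidly decaying datum has
  `∫⁻ ‖u₀‖ₑ^q < ⊤` for every `q ≥ 1` (`|u₀| ≤ C(1+|x|)^{-4}`, `(1+|x|)^{-4q} ≤ (1+|x|)^{-4}`, Mathlib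
  `finite_integral_one_add_norm`).

`SuperEnergyJaw_of : LebesgueExponentPincer.SuperEnergyJaw` is the ONLY theorem of this file concluding
the crux (A12 layer invariant of `#h21_check_skeleton`: conclusion = the crux BY NAME, no `Prop`
hypotheses, the only placeholders sit inside the two declared `stub_*` theorems, which it uses by name).
Proof (real, ENNReal arithmetic): take the gauge `c` of `stub_pressureWorkBound`; for `t ∈ [0, T)` drop
the dissipation in `stub_qEnergyInequality`, enlarge `Π_q(c; t) ≤ Π_q(c; T)` (`lintegral_mono_set`,
`Ioo 0 t ⊆ Ioo 0 T`), so `∫⁻|u t|ₑ^q ≤ B := ∫⁻|u 0|ₑ^q + ofReal(q(q-2))·Π_q(c; T) < ⊤`; then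
`eLpNorm (u t) (ofReal q) = (∫⁻|u t|ₑ^q)^{1/q} ≤ B^{1/q}` (`eLpNorm_eq_lintegral_rpow_enorm`,
`ENNReal.rpow_le_rpow`) and the `iSup₂` is `≤ B^{1/q} < ⊤`.

HONEST NOTE. All open content sits in `stub_pressureWorkBound`; `stub_qEnergyInequality` is a genuine but
provable lemma (identification with the mild solution + decay persistence + the `|u|^{q-2}u` computation),
not bookkeeping. Neither stub is cheaply the crux or the summit — BC3 probes (registrar folder
`bc/probe_*.lean`, quoted in `Lines/birth.md`): for each stub `S`, `S → SuperEnergyJaw` and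
`S → NavierStokesRegularity` by `first | exact? | simpa | aesop` (and unfolding variants) FAIL.

Disproof used: none exists for this crux (`ledger crux ls stmt-NavierStokesRegularity-19240`: no workfiles
before this one; no `Disproof.lean`, no `Negative/` lemma); `ledger negatives --problem NavierStokesRegularity`
consulted — no refuted statement of the summit is an instance of either stub (the negatives nearest in
vocabulary concern Type-I rates, `L³`/`L^{3,∞}` profiles and vorticity-direction criteria, none an `L^q`,
`q < 3`, a-priori bound or a pressure-work functional).
-/

noncomputable section

-- the summit and its single sub-problem share the name `NavierStokesRegularity` (D-0017 nested layout)
set_option linter.dupNamespace false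
set_option linter.unusedVariables false

namespace Summit.NavierStokesRegularity.NavierStokesRegularity.Cruxes.SuperEnergyJaw.Birth

open Set MeasureTheory
open scoped ENNReal
open Literature.Analysis.FluidPDE
open Summit.NavierStokesRegularity.NavierStokesRegularity.Theses.LebesgueExponentPincer

local notation "ℝ³" => EuclideanSpace ℝ (Fin 3)

/-! ## Stubs -/

/-- **stub 1 — `stub_qEnergyInequality` (M/L, PROVABLE NOW): the `L^q` energy inequality in a free
pressure gauge.** For `q > 2`, a classical Navier–Stokes solution `(u, p)` on `ℝ³ × [0, T)` (`f = 0`) that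
is Leray–Hopf on `[0, T)` from its rapidly decaying datum `u 0` satisfies, for EVERY gauge `c : ℝ → ℝ` and
every `t ∈ [0, T)`,
`∫|u(t)|^q + qν ∫₀ᵗ∫ |u|^{q-2} ‖∇u‖² ≤ ∫|u(0)|^q + q(q-2) ∫₀ᵗ∫ |p - c(s)| |u|^{q-2} ‖∇u‖`
(lower Lebesgue integrals; `‖∇u‖` = operator norm of `fderiv ℝ (u s) x`). Mechanism: multiplier
`|u|^{q-2}u`, exact transport cancellation `∫(u·∇u)·|u|^{q-2}u = 0`, `-∫Δu·|u|^{q-2}u ≥ ∫|u|^{q-2}‖∇u‖²`,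
`-∫∇p·|u|^{q-2}u = ∫(p-c)div(|u|^{q-2}u) ≤ (q-2)∫|p-c||u|^{q-2}‖∇u‖`; the work is the a-priori spatial
decay of `u, ∇u, p` for `t < T` (mild-solution identification by weak–strong uniqueness, persistence of
polynomial decay) justifying the integrations by parts.
[cite: arXiv:2111.14776, p. 4 (q-energy inequality); LemarieRieusset2016, Ch. 7] [status: open] -/
theorem stub_qEnergyInequality :
    ∀ q : ℝ, 2 < q → ∀ (ν T : ℝ), 0 < ν → 0 < T →
      ∀ (u : ℝ → EuclideanSpace ℝ (Fin 3) → EuclideanSpace ℝ (Fin 3)) (p : ℝ → EuclideanSpace ℝ (Fin 3) → ℝ),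
        Literature.Analysis.FluidPDE.IsClassicalNSSolutionOn (Set.Ico 0 T) ν 0 u p →
        Literature.Analysis.FluidPDE.IsLerayHopfOn T ν 0 (u 0) u →
        Literature.Analysis.FluidPDE.HasRapidSpatialDecay (u 0) →
        ∀ (c : ℝ → ℝ) (t : ℝ), t ∈ Set.Ico 0 T →
          (∫⁻ x, ‖u t x‖ₑ ^ q) +
              ENNReal.ofReal (q * ν) *
                ∫⁻ s in Set.Ioo 0 t, ∫⁻ x, ‖u s x‖ₑ ^ (q - 2) * ‖fderiv ℝ (u s) x‖ₑ ^ 2 ≤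
            (∫⁻ x, ‖u 0 x‖ₑ ^ q) +
              ENNReal.ofReal (q * (q - 2)) *
                ∫⁻ s in Set.Ioo 0 t, ∫⁻ x, ‖p s x - c s‖ₑ * ‖u s x‖ₑ ^ (q - 2) * ‖fderiv ℝ (u s) x‖ₑ := by
  sorry

/-- **stub 2 — `stub_pressureWorkBound` (XL, OPEN — the open content of K1): finiteness of the
gauge-fixed pressure-work functional for `q < 3`.** For `q ∈ (2, 3)` and a classical Navier–Stokes solution
`(u, p)` on `ℝ³ × [0, T)` (`f = 0`) that is Leray–Hopf on `[0, T)` from its rapidly decaying datum, there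
is a pressure gauge `c : ℝ → ℝ` with
`Π_q(c; T) = ∫₀ᵀ∫ |p - c(s)| |u|^{q-2} ‖∇u‖ < ∞` (lower Lebesgue integrals). A priori, blow-up at `T`
or not; never the critical exponent `q = 3`. Nearest proved neighbour: finite when `p ∈ L^∞_t L^{3/2,∞}_x`
(Barker, Thm 1). Why it might fail: a Type-II energy atom at the first singular time forces `Π_q = ∞`.
[cite: arXiv:2111.14776, Thm 1 and p. 4; arXiv:1705.04420; arXiv:2211.16215, §9] [status: open] -/
theorem stub_pressureWorkBound :
    ∀ q : ℝ, 2 < q → q < 3 → ∀ (ν T : ℝ), 0 < ν → 0 < T →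
      ∀ (u : ℝ → EuclideanSpace ℝ (Fin 3) → EuclideanSpace ℝ (Fin 3)) (p : ℝ → EuclideanSpace ℝ (Fin 3) → ℝ),
        Literature.Analysis.FluidPDE.IsClassicalNSSolutionOn (Set.Ico 0 T) ν 0 u p →
        Literature.Analysis.FluidPDE.IsLerayHopfOn T ν 0 (u 0) u →
        Literature.Analysis.FluidPDE.HasRapidSpatialDecay (u 0) →
        ∃ c : ℝ → ℝ,
          (∫⁻ s in Set.Ioo 0 T, ∫⁻ x, ‖p s x - c s‖ₑ * ‖u s x‖ₑ ^ (q - 2) * ‖fderiv ℝ (u s) x‖ₑ) < ⊤ := by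
  sorry

/-! ## Proved helper: the datum lies in every `L^q`, `q ≥ 1` -/

/-- A rapidly decaying field on `ℝ³` has `∫⁻ ‖u₀‖ₑ^q < ⊤` for every real `q ≥ 1`: the decay bound with
`n = 0`, `K = 4` gives `‖u₀ x‖ ≤ C (1 + ‖x‖)^{-4}`, hence `‖u₀ x‖^q ≤ C^q (1 + ‖x‖)^{-4}` (the weight is
`≤ 1` and `q ≥ 1`), and `∫ (1 + ‖x‖)^{-4} < ∞` on `ℝ³` (Mathlib `finite_integral_one_add_norm`). [folklore] -/
theorem lintegral_rpow_enorm_lt_top_of_hasRapidSpatialDecay {u₀ : ℝ³ → ℝ³}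
    (h : HasRapidSpatialDecay u₀) {q : ℝ} (hq : 1 ≤ q) :
    ∫⁻ x, ‖u₀ x‖ₑ ^ q < ⊤ := by
  obtain ⟨C, hC⟩ := h 0 4
  have hC0 : 0 ≤ C := le_trans (by positivity) (hC 0)
  have hq0 : 0 ≤ q := by linarith
  have hpt : ∀ x : ℝ³, ‖u₀ x‖ₑ ^ q ≤
      ENNReal.ofReal (C ^ q) * ENNReal.ofReal ((1 + ‖x‖) ^ (-(4 : ℝ))) := by
    intro x
    have hx : 0 < 1 + ‖x‖ := by positivity
    have hw : (1 + ‖x‖) ^ (-(4 : ℝ)) = ((1 + ‖x‖) ^ (4 : ℕ))⁻¹ := by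
      rw [Real.rpow_neg hx.le]
      norm_num
    have hw0 : 0 < (1 + ‖x‖) ^ (-(4 : ℝ)) := Real.rpow_pos_of_pos hx _
    have hw1 : (1 + ‖x‖) ^ (-(4 : ℝ)) ≤ 1 :=
      Real.rpow_le_one_of_one_le_of_nonpos (by linarith [norm_nonneg x]) (by norm_num)
    have h1 : ‖u₀ x‖ ≤ C * (1 + ‖x‖) ^ (-(4 : ℝ)) := by
      have hCx := hC x
      rw [norm_iteratedFDeriv_zero] at hCx
      rw [hw, ← div_eq_mul_inv, le_div_iff₀ (by positivity), mul_comm]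
      exact hCx
    have h2 : ‖u₀ x‖ ^ q ≤ C ^ q * (1 + ‖x‖) ^ (-(4 : ℝ)) := by
      calc ‖u₀ x‖ ^ q ≤ (C * (1 + ‖x‖) ^ (-(4 : ℝ))) ^ q :=
            Real.rpow_le_rpow (norm_nonneg _) h1 hq0
        _ = C ^ q * ((1 + ‖x‖) ^ (-(4 : ℝ))) ^ q := Real.mul_rpow hC0 hw0.le
        _ ≤ C ^ q * ((1 + ‖x‖) ^ (-(4 : ℝ))) ^ (1 : ℝ) :=
            mul_le_mul_of_nonneg_left (Real.rpow_le_rpow_of_exponent_ge hw0 hw1 hq)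
              (Real.rpow_nonneg hC0 q)
        _ = C ^ q * (1 + ‖x‖) ^ (-(4 : ℝ)) := by rw [Real.rpow_one]
    calc ‖u₀ x‖ₑ ^ q = ENNReal.ofReal (‖u₀ x‖ ^ q) := by
          rw [← ofReal_norm, ENNReal.ofReal_rpow_of_nonneg (norm_nonneg _) hq0]
      _ ≤ ENNReal.ofReal (C ^ q * (1 + ‖x‖) ^ (-(4 : ℝ))) := ENNReal.ofReal_le_ofReal h2
      _ = ENNReal.ofReal (C ^ q) * ENNReal.ofReal ((1 + ‖x‖) ^ (-(4 : ℝ))) :=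
          ENNReal.ofReal_mul (Real.rpow_nonneg hC0 q)
  have hr : (Module.finrank ℝ ℝ³ : ℝ) < (4 : ℝ) := by
    rw [finrank_euclideanSpace, Fintype.card_fin]
    norm_num
  calc ∫⁻ x, ‖u₀ x‖ₑ ^ q
      ≤ ∫⁻ x : ℝ³, ENNReal.ofReal (C ^ q) * ENNReal.ofReal ((1 + ‖x‖) ^ (-(4 : ℝ))) :=
        lintegral_mono hpt
    _ = ENNReal.ofReal (C ^ q) * ∫⁻ x : ℝ³, ENNReal.ofReal ((1 + ‖x‖) ^ (-(4 : ℝ))) :=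
        lintegral_const_mul' _ _ ENNReal.ofReal_ne_top
    _ < ⊤ := ENNReal.mul_lt_top ENNReal.ofReal_lt_top (finite_integral_one_add_norm hr)

/-! ## Composition -/

/-- **Birth composition (the skeleton theorem, A12 shape).** The crux `SuperEnergyJaw` BY NAME from the
two registered stubs, used by name: the gauge of `stub_pressureWorkBound` makes the right side of
`stub_qEnergyInequality` a finite bound `B`, uniform in `t ∈ [0, T)` (monotonicity of the pressure-work
integral in `t`, datum in `L^q` by `lintegral_rpow_enorm_lt_top_of_hasRapidSpatialDecay`), and
`eLpNorm (u t) q = (∫⁻ ‖u t‖ₑ^q)^{1/q} ≤ B^{1/q} < ⊤`. No `Prop` hypotheses; no placeholder outside the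
stubs. -/
theorem SuperEnergyJaw_of :
    _root_.Summit.NavierStokesRegularity.NavierStokesRegularity.Theses.LebesgueExponentPincer.SuperEnergyJaw := by
  intro q hq2 hq3 ν T hν hT u p hcl hLH hdec
  -- the gauge with finite pressure work (stub 2) and the finite datum term
  obtain ⟨c, hPW⟩ := stub_pressureWorkBound q hq2 hq3 ν T hν hT u p hcl hLH hdec
  have hA : ∫⁻ x, ‖u 0 x‖ₑ ^ q < ⊤ :=
    lintegral_rpow_enorm_lt_top_of_hasRapidSpatialDecay hdec (by linarith)
  set PW : ℝ≥0∞ :=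
    ∫⁻ s in Set.Ioo 0 T, ∫⁻ x, ‖p s x - c s‖ₑ * ‖u s x‖ₑ ^ (q - 2) * ‖fderiv ℝ (u s) x‖ₑ with hPWdef
  set B : ℝ≥0∞ := (∫⁻ x, ‖u 0 x‖ₑ ^ q) + ENNReal.ofReal (q * (q - 2)) * PW with hBdef
  have hB : B < ⊤ := ENNReal.add_lt_top.2 ⟨hA, ENNReal.mul_lt_top ENNReal.ofReal_lt_top hPW⟩
  -- uniform bound on the q-th powers from the q-energy inequality (stub 1)
  have hpow : ∀ t ∈ Set.Ico 0 T, ∫⁻ x, ‖u t x‖ₑ ^ q ≤ B := by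
    intro t ht
    have h1 := stub_qEnergyInequality q hq2 ν T hν hT u p hcl hLH hdec c t ht
    have hmono :
        (∫⁻ s in Set.Ioo 0 t, ∫⁻ x, ‖p s x - c s‖ₑ * ‖u s x‖ₑ ^ (q - 2) * ‖fderiv ℝ (u s) x‖ₑ) ≤ PW :=
      lintegral_mono_set (Set.Ioo_subset_Ioo_right (le_of_lt ht.2))
    calc ∫⁻ x, ‖u t x‖ₑ ^ q
        ≤ (∫⁻ x, ‖u t x‖ₑ ^ q) + ENNReal.ofReal (q * ν) *
            ∫⁻ s in Set.Ioo 0 t, ∫⁻ x, ‖u s x‖ₑ ^ (q - 2) * ‖fderiv ℝ (u s) x‖ₑ ^ 2 := le_self_add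
      _ ≤ (∫⁻ x, ‖u 0 x‖ₑ ^ q) + ENNReal.ofReal (q * (q - 2)) *
            ∫⁻ s in Set.Ioo 0 t, ∫⁻ x, ‖p s x - c s‖ₑ * ‖u s x‖ₑ ^ (q - 2) * ‖fderiv ℝ (u s) x‖ₑ := h1
      _ ≤ B := by
          rw [hBdef]
          gcongr
  -- pass to `eLpNorm` and to the supremum over `t ∈ [0, T)`
  have hq0 : 0 < q := by linarith
  have hqne : ENNReal.ofReal q ≠ 0 := by
    rw [Ne, ENNReal.ofReal_eq_zero, not_le]; exact hq0
  have hnorm : ∀ t ∈ Set.Ico 0 T, eLpNorm (u t) (ENNReal.ofReal q) volume ≤ B ^ (1 / q) := by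
    intro t ht
    rw [eLpNorm_eq_lintegral_rpow_enorm_toReal hqne ENNReal.ofReal_ne_top, ENNReal.toReal_ofReal hq0.le]
    exact ENNReal.rpow_le_rpow (hpow t ht) (by positivity)
  have hsup : (⨆ t ∈ Set.Ico 0 T, eLpNorm (u t) (ENNReal.ofReal q) volume) ≤ B ^ (1 / q) :=
    iSup₂_le hnorm
  exact lt_of_le_of_lt hsup (ENNReal.rpow_lt_top_of_nonneg (by positivity) hB.ne)

end Summit.NavierStokesRegularity.NavierStokesRegularity.Cruxes.SuperEnergyJaw.Birth

end
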